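import Literature.Probability.Percolation.AdjRouteOK
import Literature.Probability.Percolation.AdjSep
import HarnessLib

/-!
# The move of the adjacent outer landing: two exits of one colour land on consecutive sides

Topic `Literature/Probability/Percolation`; family `crit-perc` / near-critical percolation on `𝕋`.
A brick of the near-critical arm-separation theorem for four arms in the ADJACENT colour
arrangement (P. Nolin, EJP 13 (2008), Thm. 11, `j = 4`, `σ = BBWW` [arXiv 0711.4948: Thm. 10],
landing step, §4.3 Prop. 12, Lemma 13, §4.4); the adjacent twin of `Slot4.move_one`/`move`
(`ArmSeparationOutLandingFour.lean`).

For a valid adjacent rung and a slot with the routing predicate (`ASlot.RouteOK`):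

* `ASlot.efacts` — numeric facts of an exit (scale, ring, spoke, approach); `align` — the spoke row
  of every exit is a piece boundary of every ring (windows on the ring grid);
* the pieces of the corridor of an exit in frame coordinates (`spk`, `apr`, `tgtS`, `arcs`) and
  the exterior footprint box (`zone`), where they are (cones, norms, rows);
* the pair lemmas: for distinct exits `a ≠ a'`, in the reading ring of `a`, the arc of `a` misses the
  spoke / approach strip / target strip / arc of `a'` (`arcs_disjoint_*`, windows and norm bands),
  spokes, strips and footprints of distinct exits miss each other (rows on a common side, cones
  otherwise);
* **`regions_disjoint`** — the two regions of `extOpenDuoR_of_exits'` for the two exits of one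
  colour are disjoint; **`move`** — on `armsE b ∩ corrE b` the reading configuration of the colour
  `b` lies in `extOpenDuoR n (4M)`.

Everything here is proved; no named facts are introduced.

## References

* P. Nolin, Near-critical percolation in two dimensions, *Electron. J. Probab.* 13 (2008), §4.2
  Def. 6–8, §4.3 Prop. 12, Lemma 13, §4.4 (arXiv 0711.4948: Def. 6–8, Prop. 11, Lemma 12; proof of
  Thm. 10, p. 12–13), σ = BBWW [Nolin2008].
-/

noncomputable section

open Set

namespace Literature.Probability.Percolation

open LatticeModels Tube Lanes AdjTipData

namespace ASlot

variable {P : OParams} {σ : ASlot}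

/-! ### Numeric facts of an exit -/

/-- **Numeric facts of the exit `a`** of a routed slot in a valid adjacent rung. [folklore] -/
theorem efacts (hV : P.ValidA) (hR : σ.RouteOK P) (a : Fin 4) :
    (P.k₀ : ℤ) ≤ σ.k P a ∧ 32 * (σ.k P a : ℤ) ≤ P.μ ∧ 4 * (P.sA : ℤ) = P.k₀ ∧ (P.w : ℤ) = P.sA ∧ 16 * (P.ε : ℤ) ≤ P.k₀ ∧
      16 * (P.eA : ℤ) ≤ P.k₀ ∧ 1 ≤ (P.eA : ℤ) ∧ 3 * (P.eA : ℤ) < P.sA ∧ 64 ≤ (P.k₀ : ℤ) ∧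
      ((σ.nE P a : ℕ) : ℤ) * P.sA = σ.rE P a ∧ 1 ≤ σ.nE P a ∧ σ.GE P a = 12 * σ.nE P a - 4 ∧
      2 * (P.M : ℤ) + (2 * σ.lv a + 1) * P.μ < σ.rE P a ∧ (σ.rE P a : ℤ) ≤ 2 * P.M + (2 * σ.lv a + 1) * P.μ + P.k₀ ∧
      (σ.rE P a : ℤ) + 2 * P.sA ≤ 4 * P.M ∧ (σ.L P a : ℤ) = (2 * σ.lv a + 1) * P.μ + 3 * P.k₀ + (4 * P.e - P.k₀ : ℤ) ∧
      (σ.rE P a : ℤ) - 2 * P.eA + σ.W P a = 4 * P.M + (4 * P.M / 16 : ℕ) ∧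
      (-(2 * (P.M : ℤ)) + 2 * P.sA ≤ σ.ξ P a ∧ σ.ξ P a + 2 * P.ε + 4 * P.sA < 0) ∧
      (P.n : ℤ) ≤ P.M ∧ 64 * (P.μ : ℤ) ≤ P.M ∧ 8 * (P.μ : ℤ) ≤ P.R₀ ∧ 4 * (P.R₀ : ℤ) ≤ P.M ∧ 4 * (P.e : ℤ) ≤ P.k₀ ∧ (P.k₀ : ℤ) ≤ 4 * P.e + 3 := by
  obtain ⟨hs, hk₀, hμ, hw1, hw2, he1, he2, hε1, -, -, -, -, -, -, -, hN, -, -, hn, hμM, hR₀, hR₀M, -⟩ := hV.toValid.ifacts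
  have hk1 : (P.k₀ : ℤ) ≤ σ.k P a := by exact_mod_cast le_trapScale P.k₀ (σ.j a)
  have hk2 : 32 * (σ.k P a : ℤ) ≤ P.μ := by exact_mod_cast P.scale_le (hR.hj a)
  obtain ⟨hsA, hsA16⟩ := hV.sA_facts
  obtain ⟨ea1, -, ea3, ea4, -, ea6⟩ := hV.eA_facts
  have hlv := hR.hlv a
  obtain ⟨r1, r2, -, -, -, r6, -, r8⟩ := hV.toValid.ring_facts hlv
  obtain ⟨-, n2, n3, -, n5⟩ := hV.ringA_facts hlv
  have hWA := ea6 _ hlv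
  have hsk : (P.s : ℤ) = P.k₀ := hs
  have hwsA : (P.w : ℤ) = P.sA := by norm_cast
  have he' : (P.e : ℤ) = (P.k₀ / 4 : ℕ) := by norm_cast
  refine ⟨hk1, hk2, by exact_mod_cast hsA, hwsA, hε1, by exact_mod_cast ea1, by exact_mod_cast ea4, by exact_mod_cast ea3, hk₀,
    n5, n2, rfl, ?_, ?_, ?_, ?_, ?_, hR.hξ a, hn, hμM, hR₀, hR₀M, he1, he2⟩
  · show 2 * (P.M : ℤ) + (2 * σ.lv a + 1) * P.μ < P.rL (σ.lv a); exact_mod_cast r1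
  · show (P.rL (σ.lv a) : ℤ) ≤ 2 * P.M + (2 * σ.lv a + 1) * P.μ + P.k₀
    have : (P.rL (σ.lv a) : ℤ) ≤ 2 * P.M + (2 * σ.lv a + 1) * P.μ + P.s := by exact_mod_cast r2
    rwa [hsk] at this
  · show (P.rL (σ.lv a) : ℤ) + 2 * P.sA ≤ 4 * P.M
    have : (P.rL (σ.lv a) : ℤ) + 2 * P.e ≤ 4 * P.M := by exact_mod_cast r6
    have hesA : (P.e : ℤ) = P.sA := by norm_cast
    linarith
  · show (P.LL (σ.lv a) : ℤ) = _
    rw [r8]; push_cast; rw [hsk]; ring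
  · show (P.rL (σ.lv a) : ℤ) - 2 * P.eA + P.WA (σ.lv a) = _
    rw [hWA]
    have hN4 : P.N' = 4 * P.M := rfl
    rw [hN4]; push_cast; ring

/-- **Alignment**: the spoke row of the exit `a'` is a piece boundary of the ring of the exit `a`:
`-rE a + ι sA = ξ a'` for `ι = latIdx sA (rE a) (ξ a')`, with `2 ≤ ι` and `ι + 3 ≤ nE a`. [folklore] -/
theorem align (hV : P.ValidA) (hR : σ.RouteOK P) (a a' : Fin 4) :
    -(σ.rE P a : ℤ) + (latIdx P.sA (σ.rE P a) (σ.ξ P a') : ℕ) * P.sA = σ.ξ P a' ∧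
      2 ≤ latIdx P.sA (σ.rE P a) (σ.ξ P a') ∧ latIdx P.sA (σ.rE P a) (σ.ξ P a') + 3 ≤ σ.nE P a := by
  obtain ⟨-, -, hsA, hw, -, -, -, -, hk₀, hns, hn1, -, r1, -, -, -, -, -, -⟩ := efacts hV hR a
  obtain ⟨-, -, -, -, -, -, -, -, -, -, -, -, -, -, -, -, -, ⟨x1, x2⟩, -⟩ := efacts hV hR a'
  have hsA16 := hV.sA_facts.2
  have hs1 : 1 ≤ P.sA := by omega
  have hfour : 4 ∣ P.k₀ := hV.hfour
  -- `ξ a' + rE a` is a multiple of `sA`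
  have hdiv : (P.sA : ℤ) ∣ σ.ξ P a' + σ.rE P a := by
    have h0 : (P.sA : ℤ) ∣ (P.rL 0 : ℤ) := by
      obtain ⟨-, -, -, -, h5⟩ := hV.ringA_facts (show 0 < 8 by norm_num)
      exact ⟨P.nA 0, by rw [← h5]; ring⟩
    have h1 : (P.sA : ℤ) ∣ (σ.rE P a : ℤ) := ⟨σ.nE P a, by rw [← hns]; ring⟩
    have hk : (P.sA : ℤ) ∣ (σ.k P a' : ℤ) := by
      refine ⟨4 * 32 ^ σ.j a', ?_⟩
      show ((trapScale P.k₀ (σ.j a') : ℕ) : ℤ) = _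
      unfold trapScale; push_cast; rw [← hsA]; ring
    have hk4 : (P.sA : ℤ) ∣ ((σ.k P a' / 4 : ℕ) : ℤ) := by
      refine ⟨32 ^ σ.j a', ?_⟩
      show (((trapScale P.k₀ (σ.j a')) / 4 : ℕ) : ℤ) = _
      unfold trapScale
      obtain ⟨q, hq⟩ := hfour
      have hsq : P.sA = q := by unfold OParams.sA; omega
      rw [hq, hsq, show 4 * q * 32 ^ σ.j a' / 4 = q * 32 ^ σ.j a' by rw [Nat.mul_assoc, Nat.mul_div_cancel_left _ (by norm_num)]]
      push_cast; ring
    have hT : (P.sA : ℤ) ∣ σ.T P a' + P.rL 0 := by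
      refine ⟨σ.ν a', ?_⟩; unfold ASlot.T OParams.TA; ring
    have e1 : σ.ξ P a' + σ.rE P a = (σ.T P a' + P.rL 0) - P.rL 0 + P.w + σ.k P a' + (σ.k P a' / 4 : ℕ) + σ.rE P a := by
      unfold ASlot.ξ; ring
    rw [e1, hw]
    exact ((((hT.sub h0).add (dvd_refl _)).add hk).add hk4).add h1
  have hμ0 : (0 : ℤ) ≤ P.μ := by positivity
  have hl0 : (0 : ℤ) ≤ σ.lv a := by positivity
  have hM2 : (2 * P.M : ℤ) ≤ σ.rE P a := by
    have h1 : (0 : ℤ) ≤ (2 * σ.lv a + 1) * P.μ := by positivity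
    linarith
  have hs0 : (0 : ℤ) ≤ P.sA := by positivity
  have hξr : -(σ.rE P a : ℤ) ≤ σ.ξ P a' := by linarith
  have hspec := latIdx_spec (s := P.sA) (r := σ.rE P a) hs1 hξr
  -- exactness from divisibility
  have heq : -(σ.rE P a : ℤ) + (latIdx P.sA (σ.rE P a) (σ.ξ P a') : ℕ) * P.sA = σ.ξ P a' := by
    obtain ⟨q, hq⟩ := hdiv
    have hs0 : (0 : ℤ) < P.sA := by exact_mod_cast hs1
    have h1 : ((latIdx P.sA (σ.rE P a) (σ.ξ P a') : ℕ) : ℤ) ≤ q := by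
      by_contra h; push Not at h
      have : q + 1 ≤ (latIdx P.sA (σ.rE P a) (σ.ξ P a') : ℕ) := by omega
      nlinarith [hspec.1]
    have h2 : q ≤ (latIdx P.sA (σ.rE P a) (σ.ξ P a') : ℕ) := by
      by_contra h; push Not at h
      have : ((latIdx P.sA (σ.rE P a) (σ.ξ P a') : ℕ) : ℤ) + 1 ≤ q := by omega
      nlinarith [hspec.2]
    have : ((latIdx P.sA (σ.rE P a) (σ.ξ P a') : ℕ) : ℤ) = q := le_antisymm h1 h2
    rw [this]; linarith
  have hε : (0 : ℤ) ≤ P.ε := by positivity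
  have hlt := latIdx_add_lt (s := P.sA) (r := σ.rE P a) (n := σ.nE P a) (m := 2) hs1 hns hξr (by push_cast; linarith)
  refine ⟨heq, ?_, by omega⟩
  -- `ξ ≥ -2M + 2sA ≥ -rE + 2 sA`
  by_contra h; push Not at h
  have h1 : ((latIdx P.sA (σ.rE P a) (σ.ξ P a') : ℕ) : ℤ) ≤ 1 := by omega
  nlinarith

/-! ### The pieces of the corridor of an exit (frame coordinates) -/

variable (P σ)

/-- the spoke box of the exit `a` [folklore] -/
def spk (a : Fin 4) : Set (Site 2) := (extSpokeTube P.M (σ.k P a) (σ.T P a) P.w (σ.L P a) P.ε).box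
/-- the approach strip of the exit `a` (in its reading frame, to the right side) [folklore] -/
def apr (a : Fin 4) : Set (Site 2) := triStrip ((σ.rE P a : ℤ) - 2 * P.eA) (σ.tr P a) (σ.W P a) (4 * P.M / 64)
/-- the thinned target strip of the exit `a` [folklore] -/
def tgtS (a : Fin 4) : Set (Site 2) :=
  triStrip ((4 * P.M : ℕ) + 1) (σ.tr P a - (4 * P.M / 64 : ℕ)) (4 * P.M / 16 - 1) (2 * (4 * P.M / 64))
/-- the boxes of the arc of the exit `a` [folklore] -/
def arcs (a : Fin 4) : Set (Site 2) := boxAll (arc (thinRing (σ.rE P a) P.eA P.sA) (σ.ast a) (σ.aln a))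
/-- the exterior footprint box of the exit `a` [folklore] -/
def zone (a : Fin 4) : Set (Site 2) := zoneBox P.M (σ.k P a) (σ.T P a) P.w

variable {P σ}

/-- **Where the spoke box is**: rows `[ξ, ξ + 2ε]`, depths `[2M + k, 2M + k + L]`; in the cone; norms. [folklore] -/
theorem spk_facts (hV : P.ValidA) (hR : σ.RouteOK P) (a : Fin 4) :
    (∀ u ∈ σ.spk P a, σ.ξ P a ≤ u 1 ∧ u 1 ≤ σ.ξ P a + 2 * P.ε) ∧
      (∀ u ∈ σ.spk P a, u 1 ≤ -1 ∧ 1 ≤ u 0 + u 1) ∧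
      (∀ u ∈ σ.spk P a, 2 * (P.M : ℤ) + 1 ≤ u 0 ∧ -(2 * (P.M : ℤ)) ≤ u 1 ∧ u 1 ≤ 0) ∧
      (∀ u ∈ σ.spk P a, 2 * (P.M : ℤ) + σ.k P a ≤ u 0 ∧ u 0 ≤ 2 * (P.M : ℤ) + σ.k P a + σ.L P a) ∧
      (∀ u ∈ σ.spk P a, u 1 ≤ -(2 * (P.eA : ℤ) + 1) ∧ 2 * (P.eA : ℤ) + 1 ≤ u 0 + u 1) := by
  obtain ⟨hk1, -, hsA, hw, hε1, he1, -, he3, hk₀, -, -, -, -, -, -, -, -, ⟨x1, x2⟩, -⟩ := efacts hV hR a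
  have hξ : ∀ u ∈ σ.spk P a, (2 * (P.M : ℤ) + σ.k P a ≤ u 0 ∧ u 0 ≤ 2 * (P.M : ℤ) + σ.k P a + σ.L P a) ∧
      σ.ξ P a ≤ u 1 ∧ u 1 ≤ σ.ξ P a + 2 * P.ε := by
    intro u hu
    unfold spk at hu
    rw [Tube.mem_box] at hu
    simp only [extSpokeTube, Nat.cast_mul, Nat.cast_ofNat] at hu
    unfold ASlot.ξ
    exact ⟨⟨hu.1, hu.2.1⟩, hu.2.2.1, hu.2.2.2⟩
  have hε : (0 : ℤ) ≤ P.ε := by positivity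
  have hM0 : (0 : ℤ) ≤ P.M := by positivity
  have hs0 : (0 : ℤ) ≤ P.sA := by positivity
  refine ⟨fun u hu => (hξ u hu).2, fun u hu => ?_, fun u hu => ?_, fun u hu => (hξ u hu).1, fun u hu => ?_⟩ <;>
    obtain ⟨⟨d1, d2⟩, r1, r2⟩ := hξ u hu
  · exact ⟨by linarith, by linarith⟩
  · exact ⟨by linarith, by linarith, by linarith⟩
  · exact ⟨by linarith, by linarith⟩

/-- **Where the approach strip is**: rows `[tr, tr + 4M/64]`, depths from `rE - 2eA`; in the cone. [folklore] -/
theorem apr_facts (hV : P.ValidA) (hR : σ.RouteOK P) (a : Fin 4) :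
    (∀ u ∈ σ.apr P a, σ.tr P a ≤ u 1 ∧ u 1 ≤ σ.tr P a + (4 * P.M / 64 : ℕ)) ∧
      (∀ u ∈ σ.apr P a, u 1 ≤ -1 ∧ 1 ≤ u 0 + u 1) ∧
      (∀ u ∈ σ.apr P a, 2 * (P.M : ℤ) + 1 ≤ u 0 ∧ -(2 * (P.M : ℤ)) ≤ u 1 ∧ u 1 ≤ 0) ∧
      (∀ u ∈ σ.apr P a, (σ.rE P a : ℤ) - 2 * P.eA ≤ u 0) ∧
      (∀ u ∈ σ.apr P a, u 1 ≤ -(2 * (P.eA : ℤ) + 1) ∧ 2 * (P.eA : ℤ) + 1 ≤ u 0 + u 1) ∧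
      (-(2 * (P.M : ℤ)) + (4 * P.M / 16 : ℕ) ≤ σ.tr P a ∧ σ.tr P a ≤ -(P.M : ℤ) - (4 * P.M / 16 : ℕ)) := by
  obtain ⟨hk1, hk2, hsA, hw, hε1, he1, -, he3, hk₀, -, -, -, r1, -, -, -, -, -, -, hμM, -⟩ := efacts hV hR a
  obtain ⟨t1, t2⟩ := hV.toValid.tgtRow4_mem (hR.htc (σ.as a))
  change -(2 * (P.M : ℤ)) + (4 * P.M / 16 : ℕ) ≤ σ.tr P a at t1
  change σ.tr P a ≤ -(P.M : ℤ) - (4 * P.M / 16 : ℕ) at t2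
  have hμ0 : (0 : ℤ) ≤ P.μ := by positivity
  have hl0 : (0 : ℤ) ≤ σ.lv a := by positivity
  have hrE : 2 * (P.M : ℤ) + P.μ < σ.rE P a := by nlinarith
  have hmem : ∀ u ∈ σ.apr P a, (σ.rE P a : ℤ) - 2 * P.eA ≤ u 0 ∧ σ.tr P a ≤ u 1 ∧ u 1 ≤ σ.tr P a + (4 * P.M / 64 : ℕ) := by
    intro u hu; unfold apr at hu; rw [mem_triStrip] at hu; exact ⟨hu.1, hu.2.2.1, hu.2.2.2⟩
  refine ⟨fun u hu => (hmem u hu).2, fun u hu => ?_, fun u hu => ?_, fun u hu => (hmem u hu).1, fun u hu => ?_, t1, t2⟩ <;>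
    obtain ⟨d1, r1', r2⟩ := hmem u hu <;> constructor <;> omega

/-- **Where the target strip is**: depths `> 4M`; in the cone. [folklore] -/
theorem tgtS_facts (hV : P.ValidA) (hR : σ.RouteOK P) (a : Fin 4) :
    (∀ u ∈ σ.tgtS P a, u 1 ≤ -1 ∧ 1 ≤ u 0 + u 1) ∧ (∀ u ∈ σ.tgtS P a, 4 * (P.M : ℤ) + 1 ≤ u 0) ∧
      (∀ u ∈ σ.tgtS P a, 0 ≤ u 0 ∧ -(u 0) ≤ u 1 ∧ u 1 ≤ 0) := by
  obtain ⟨hk1, hk2, -, -, -, -, -, -, hk₀, -, -, -, -, -, -, -, -, -, -, hμM, -⟩ := efacts hV hR a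
  obtain ⟨t1, t2⟩ := hV.toValid.tgtRow4_mem (hR.htc (σ.as a))
  change -(2 * (P.M : ℤ)) + (4 * P.M / 16 : ℕ) ≤ σ.tr P a at t1
  change σ.tr P a ≤ -(P.M : ℤ) - (4 * P.M / 16 : ℕ) at t2
  have hmem : ∀ u ∈ σ.tgtS P a, ((4 * P.M : ℕ) : ℤ) + 1 ≤ u 0 ∧ σ.tr P a - (4 * P.M / 64 : ℕ) ≤ u 1 ∧
      u 1 ≤ σ.tr P a - (4 * P.M / 64 : ℕ) + (2 * (4 * P.M / 64) : ℕ) := by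
    intro u hu; unfold tgtS at hu; rw [mem_triStrip] at hu; exact ⟨hu.1, hu.2.2.1, hu.2.2.2⟩
  refine ⟨fun u hu => ?_, fun u hu => ?_, fun u hu => ?_⟩ <;> obtain ⟨d1, r1, r2⟩ := hmem u hu <;> push_cast at d1 r1 r2 ⊢ <;> omega

/-- **Where the exterior footprint is**: in the cone; norms `≤ 2M + 2k + 1`; rows. [folklore] -/
theorem zone_facts (hV : P.ValidA) (hR : σ.RouteOK P) (a : Fin 4) :
    (∀ u ∈ σ.zone P a, u 1 ≤ -1 ∧ 1 ≤ u 0 + u 1) ∧ (∀ u ∈ σ.zone P a, triNorm u ≤ 2 * (P.M : ℤ) + 2 * σ.k P a + 1) ∧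
      (∀ u ∈ σ.zone P a, σ.T P a + 1 ≤ u 1 ∧ u 1 + 1 ≤ σ.T P a + P.w + 3 * σ.k P a) ∧
      (∀ u ∈ σ.zone P a, 2 * (P.M : ℤ) + 1 ≤ u 0 ∧ -(2 * (P.M : ℤ)) ≤ u 1 ∧ u 1 ≤ 0) := by
  obtain ⟨hk1, hk2, hsA, hw, hε1, he1, -, he3, hk₀, -, -, -, -, -, -, -, -, ⟨x1, x2⟩, -, -, hR₀, hR₀M, -⟩ := efacts hV hR a
  obtain ⟨T1, T2⟩ := hR.hT a
  have htop : σ.T P a + P.w + 3 * σ.k P a ≤ 0 := by omega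
  have hbot : -(2 * (P.M : ℤ)) ≤ σ.T P a := by omega
  refine ⟨zoneBox_sector htop hbot, fun u hu => ?_, fun u hu => ⟨hu.2.2.1, hu.2.2.2⟩, fun u hu => ?_⟩
  · obtain ⟨h1, h2, h3, h4⟩ := hu
    exact triNorm_le_iff_lin.2 (by omega)
  · obtain ⟨h1, h2, h3, h4⟩ := hu
    omega

/-- **Where the arc is**: norms in `[rE - sA - 2eA, rE + 2eA]`. [folklore] -/
theorem arcs_norm (hV : P.ValidA) (hR : σ.RouteOK P) (a : Fin 4) :
    ∀ v ∈ σ.arcs P a, (σ.rE P a : ℤ) - P.sA - 2 * P.eA ≤ triNorm v ∧ triNorm v ≤ (σ.rE P a : ℤ) + 2 * P.eA := by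
  obtain ⟨hk1, hk2, hsA, -, -, he1, -, he3, hk₀, -, -, -, r1, -, -, -, -, -, -⟩ := efacts hV hR a
  have he : 2 * P.eA ≤ σ.rE P a := by
    have hμ0 : (0 : ℤ) ≤ P.μ := by positivity
    have hl0 : (0 : ℤ) ≤ σ.lv a := by positivity
    have : (2 * P.eA : ℤ) ≤ σ.rE P a := by nlinarith
    exact_mod_cast this
  exact fun v hv => norm_of_mem_boxAll_arc he hv

/-! ### Small tools -/

/-- The lateral index of a row inside a chunk. [folklore] -/
theorem latIdx_eq_of_mem {s r ι : ℕ} {x : ℤ} (hs : 1 ≤ s) (h1 : -(r : ℤ) + ι * s ≤ x) (h2 : x < -(r : ℤ) + (ι + 1) * s) :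
    latIdx s r x = ι := by
  have hι0 : (0 : ℤ) ≤ ι * s := by positivity
  have hspec := latIdx_spec (s := s) (r := r) hs (ξ := x) (by linarith)
  have hs0 : (0 : ℤ) < s := by exact_mod_cast hs
  apply le_antisymm
  · by_contra h; push Not at h
    have : (ι : ℤ) + 1 ≤ latIdx s r x := by exact_mod_cast h
    nlinarith [hspec.1]
  · by_contra h; push Not at h
    have : (latIdx s r x : ℤ) + 1 ≤ ι := by exact_mod_cast h
    nlinarith [hspec.2]

/-- The lateral index one chunk below. [folklore] -/
theorem latIdx_sub_self {s r : ℕ} {x : ℤ} (hs : 1 ≤ s) (h : -(r : ℤ) + s ≤ x) : latIdx s r (x - s) = latIdx s r x - 1 := by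
  have hs0' : (0 : ℤ) ≤ s := by positivity
  have hspec := latIdx_spec (s := s) (r := r) hs (ξ := x) (by linarith)
  have h1 : 1 ≤ latIdx s r x := by
    by_contra h0; push Not at h0
    have : latIdx s r x = 0 := by omega
    rw [this] at hspec; push_cast at hspec; linarith [hspec.2]
  apply latIdx_eq_of_mem hs
  · push_cast [Nat.cast_sub h1]; linarith [hspec.1]
  · push_cast [Nat.cast_sub h1]; linarith [hspec.2]

/-- Rotated sets with separated rows are disjoint (same rotation). [folklore] -/
theorem disjoint_image_rot_of_rows {i : ℕ} {B B' : Set (Site 2)} {y : ℤ} (hB : ∀ u ∈ B, u 1 ≤ y) (hB' : ∀ u ∈ B', y < u 1) :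
    Disjoint (triRotIsoPow i '' B) (triRotIsoPow i '' B') := by
  rw [Set.disjoint_image_iff (triRotIsoPow i).injective, Set.disjoint_left]
  intro u hu hu'
  have h1 := hB u hu; have h2 := hB' u hu'; omega

/-- Sets with separated norms are disjoint. [folklore] -/
theorem disjoint_of_norm {X Y : Set (Site 2)} {m : ℤ} (hX : ∀ v ∈ X, triNorm v ≤ m) (hY : ∀ v ∈ Y, m < triNorm v) :
    Disjoint X Y := by
  rw [Set.disjoint_left]; intro v hv hv'; have := hX v hv; have := hY v hv'; omega

/-- Norms of a rotated set from depth bounds in the cone. [folklore] -/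
theorem norm_image_rot_of_dep {i : ℕ} {B : Set (Site 2)} {p : ℤ → Prop}
    (hB : ∀ u ∈ B, 0 ≤ u 0 ∧ -(u 0) ≤ u 1 ∧ u 1 ≤ 0) (hp : ∀ u ∈ B, p (u 0)) :
    ∀ v ∈ triRotIsoPow i '' B, p (triNorm v) := by
  intro v hv
  obtain ⟨u, hu, -, hn⟩ := norm_of_mem_image_rot' hB hv
  rw [hn]; exact hp u hu

/-! ### The pair lemmas -/

/-- cone-type depth facts of the spoke box [folklore] -/
theorem spk_dep (hV : P.ValidA) (hR : σ.RouteOK P) (a : Fin 4) :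
    ∀ u ∈ σ.spk P a, 0 ≤ u 0 ∧ -(u 0) ≤ u 1 ∧ u 1 ≤ 0 := by
  intro u hu
  obtain ⟨-, -, hdep, -⟩ := spk_facts hV hR a
  obtain ⟨h1, h2, h3⟩ := hdep u hu
  exact ⟨by linarith, by linarith, h3⟩

/-- cone-type depth facts of the approach strip [folklore] -/
theorem apr_dep (hV : P.ValidA) (hR : σ.RouteOK P) (a : Fin 4) :
    ∀ u ∈ σ.apr P a, 0 ≤ u 0 ∧ -(u 0) ≤ u 1 ∧ u 1 ≤ 0 := by
  intro u hu
  obtain ⟨-, -, hdep, -⟩ := apr_facts hV hR a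
  obtain ⟨h1, h2, h3⟩ := hdep u hu
  exact ⟨by linarith, by linarith, h3⟩

/-- **P1. The arc of `a` misses the spoke of `a' ≠ a`** (read in the ring of `a`: side
`sft (ts a) (i' a')`): a higher spoke by the window (`hexclX`), a lower one by the norms. [cite: Nolin2008, §4.3 Lemma 13 (arXiv 0711.4948: Lemma 12)] -/
theorem arcs_disjoint_spk (hV : P.ValidA) (hR : σ.RouteOK P) {a a' : Fin 4} (hne : a ≠ a') :
    Disjoint (σ.arcs P a) (triRotIsoPow (sft (ts a) (σ.i' a')) '' σ.spk P a') := by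
  obtain ⟨hk1, hk2, hsA, hw, hε1, he1, he0, he3, hk₀, hns, hn1, hGE, r1, r2, r3, hL, -, ⟨x1, x2⟩, -⟩ := efacts hV hR a
  obtain ⟨hk1', hk2', -, -, -, -, -, -, -, -, -, -, r1', r2', -, hL', -, ⟨x1', x2'⟩, -, -, -, -, he4, he5⟩ := efacts hV hR a'
  obtain ⟨hrows, hsec1, hdep, hdepth, hsec⟩ := spk_facts hV hR a'
  have hsA16 := hV.sA_facts.2
  have hs1 : 1 ≤ P.sA := by omega
  have hns' : σ.nE P a * P.sA = σ.rE P a := by exact_mod_cast hns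
  have hμ0 : (0 : ℤ) ≤ P.μ := by positivity
  have hl0 : (0 : ℤ) ≤ σ.lv a := by positivity
  have he : 2 * P.eA ≤ σ.rE P a := by
    have h1 : (P.μ : ℤ) ≤ (2 * σ.lv a + 1) * P.μ := le_mul_of_one_le_left hμ0 (by linarith)
    have : (2 * P.eA : ℤ) ≤ σ.rE P a := by linarith
    exact_mod_cast this
  rcases Nat.lt_or_gt_of_ne (hR.hlv_ne a a' hne) with hl | hl
  · -- the spoke of `a'` crosses the ring of `a`: the window
    obtain ⟨hal, hι2, hι3⟩ := align hV hR a a'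
    have hε : (0 : ℤ) ≤ P.ε := by positivity
    have hι2' : (2 : ℤ) * P.sA ≤ (latIdx P.sA (σ.rE P a) (σ.ξ P a') : ℕ) * P.sA := by
      have : (2 : ℤ) ≤ (latIdx P.sA (σ.rE P a) (σ.ξ P a') : ℕ) := by exact_mod_cast hι2
      have hs0 : (0 : ℤ) ≤ P.sA := by positivity
      exact mul_le_mul_of_nonneg_right this hs0
    have hι' : latIdx P.sA (σ.rE P a) (σ.ξ P a' + 2 * P.ε) = latIdx P.sA (σ.rE P a) (σ.ξ P a') :=
      latIdx_eq_of_mem hs1 (by linarith) (by linarith)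
    have hιs : latIdx P.sA (σ.rE P a) (σ.ξ P a' - P.sA) = latIdx P.sA (σ.rE P a) (σ.ξ P a') - 1 :=
      latIdx_sub_self hs1 (by linarith)
    obtain ⟨ha1, ha2, ha3⟩ := hR.harc a
    have hlo : (σ.XO P a a').rwlo (σ.nE P a) P.sA (σ.rE P a) =
        blockOff (σ.nE P a) (sft (ts a) (σ.i' a')) + 2 * (latIdx P.sA (σ.rE P a) (σ.ξ P a' - P.sA) - 1) := rfl
    have hhi : (σ.XO P a a').rwhi (σ.nE P a) P.sA (σ.rE P a) =
        blockOff (σ.nE P a) (sft (ts a) (σ.i' a')) + 2 * (latIdx P.sA (σ.rE P a) (σ.ξ P a') + 1) + 1 := rfl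
    refine boxAll_arc_disjoint_rotRows (M := P.M) (lamS := 2 * P.eA + 1) hn1 hns' he (by rw [← hGE]; exact ha1) (by rw [← hGE]; exact ha3)
      (sft_lt _ _) hι2 (by rw [hι']; exact hι3) (by linarith) ?_ hV.eA_facts.2.2.1 (by linarith) hrows hsec hdep
    intro g hg1 hg2
    rw [hι'] at hg2
    have hex := hR.hexclX a a' hne hl g
    rw [hlo, hhi, hιs] at hex
    rw [← hGE]
    exact hex (by omega) (by omega)
  · -- the spoke of `a'` ends below the ring of `a`: the norms
    refine boxAll_arc_disjoint_of_norm he (norm_image_rot_of_dep (p := fun x => x < (σ.rE P a : ℤ) - P.sA - 2 * P.eA ∨ (σ.rE P a : ℤ) + 2 * P.eA < x)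
      (spk_dep hV hR a') fun u hu => Or.inl ?_)
    obtain ⟨d1, d2⟩ := hdepth u hu
    have hl' : (σ.lv a' : ℤ) + 1 ≤ σ.lv a := by exact_mod_cast hl
    have hμl : (2 * (σ.lv a' : ℤ) + 3) * P.μ ≤ (2 * σ.lv a + 1) * P.μ := mul_le_mul_of_nonneg_right (by linarith) hμ0
    show u 0 < _
    linarith

/-- **P2. The arc of `a` misses the approach strip of `a' ≠ a`** (read in the ring of `a`: side
`sft (ts a) (ts a')`): a lower approach by the window (`hexclY`), a higher one by the norms. [cite: Nolin2008, §4.3 Lemma 13 (arXiv 0711.4948: Lemma 12)] -/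
theorem arcs_disjoint_apr (hV : P.ValidA) (hR : σ.RouteOK P) {a a' : Fin 4} (hne : a ≠ a') :
    Disjoint (σ.arcs P a) (triRotIsoPow (sft (ts a) (ts a')) '' σ.apr P a') := by
  obtain ⟨hk1, hk2, hsA, hw, hε1, he1, he0, he3, hk₀, hns, hn1, hGE, r1, r2, r3, hL, -, ⟨x1, x2⟩, -, hμM, -⟩ := efacts hV hR a
  obtain ⟨-, -, -, -, -, -, -, -, -, -, -, -, r1', r2', -, -, -, -, -⟩ := efacts hV hR a'
  obtain ⟨hrows, hsec1, hdep, hdepth, hsec, t1, t2⟩ := apr_facts hV hR a'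
  have hsA16 := hV.sA_facts.2
  have hs1 : 1 ≤ P.sA := by omega
  have hns' : σ.nE P a * P.sA = σ.rE P a := by exact_mod_cast hns
  have hμ0 : (0 : ℤ) ≤ P.μ := by positivity
  have hl0 : (0 : ℤ) ≤ σ.lv a := by positivity
  have hl0' : (0 : ℤ) ≤ σ.lv a' := by positivity
  have he : 2 * P.eA ≤ σ.rE P a := by
    have h1 : (P.μ : ℤ) ≤ (2 * σ.lv a + 1) * P.μ := le_mul_of_one_le_left hμ0 (by linarith)
    have : (2 * P.eA : ℤ) ≤ σ.rE P a := by linarith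
    exact_mod_cast this
  have hM2 : (2 * P.M : ℤ) ≤ σ.rE P a := by
    have h1 : (0 : ℤ) ≤ (2 * σ.lv a + 1) * P.μ := by positivity
    linarith
  rcases Nat.lt_or_gt_of_ne (hR.hlv_ne a a' hne) with hl | hl
  · -- the approach of `a'` starts beyond the ring of `a`: the norms
    refine boxAll_arc_disjoint_of_norm he (norm_image_rot_of_dep (p := fun x => x < (σ.rE P a : ℤ) - P.sA - 2 * P.eA ∨ (σ.rE P a : ℤ) + 2 * P.eA < x)
      (apr_dep hV hR a') fun u hu => Or.inr ?_)
    have d1 := hdepth u hu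
    have hl' : (σ.lv a : ℤ) + 1 ≤ σ.lv a' := by exact_mod_cast hl
    have hμl : (2 * (σ.lv a : ℤ) + 3) * P.μ ≤ (2 * σ.lv a' + 1) * P.μ := mul_le_mul_of_nonneg_right (by linarith) hμ0
    show _ < u 0
    linarith
  · -- the approach of `a'` crosses the ring of `a`: the window
    have hs0 : (0 : ℤ) ≤ P.sA := by positivity
    have htr2 : -(σ.rE P a : ℤ) + 2 * P.sA ≤ σ.tr P a' := by omega
    have htr : -(σ.rE P a : ℤ) + P.sA ≤ σ.tr P a' := by linarith
    have hι2 : 2 ≤ latIdx P.sA (σ.rE P a) (σ.tr P a') := by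
      have hsp := latIdx_spec (s := P.sA) (r := σ.rE P a) hs1 (ξ := σ.tr P a') (by linarith)
      by_contra h; push Not at h
      have h1 : (latIdx P.sA (σ.rE P a) (σ.tr P a') : ℤ) ≤ 1 := by omega
      have h2 : ((latIdx P.sA (σ.rE P a) (σ.tr P a') : ℤ) + 1) * P.sA ≤ 2 * P.sA := mul_le_mul_of_nonneg_right (by linarith) hs0
      linarith [hsp.2]
    have hι3 : latIdx P.sA (σ.rE P a) (σ.tr P a' + (4 * P.M / 64 : ℕ)) + 3 ≤ σ.nE P a := by
      have h := latIdx_add_lt (s := P.sA) (r := σ.rE P a) (n := σ.nE P a) (m := 2) hs1 hns (ξ := σ.tr P a' + (4 * P.M / 64 : ℕ))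
        (by linarith) (by push_cast; omega)
      omega
    have hιs : latIdx P.sA (σ.rE P a) (σ.tr P a' - P.sA) = latIdx P.sA (σ.rE P a) (σ.tr P a') - 1 := latIdx_sub_self hs1 htr
    obtain ⟨d1, d2⟩ := hV.dA_facts
    have hmono0 : latIdx P.sA (σ.rE P a) (σ.tr P a') ≤ latIdx P.sA (σ.rE P a) (σ.tr P a' + (4 * P.M / 64 : ℕ)) :=
      latIdx_mono (by have : (0 : ℤ) ≤ ((4 * P.M / 64 : ℕ) : ℤ) := by positivity
                      linarith)
    have hmono : latIdx P.sA (σ.rE P a) (σ.tr P a' + (4 * P.M / 64 : ℕ)) ≤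
        latIdx P.sA (σ.rE P a) (σ.tr P a' + ((P.dA - 1 : ℕ) : ℤ) * P.sA) :=
      latIdx_mono (by linarith [(show ((4 * P.M / 64 : ℕ) : ℤ) = ((P.N' / 64 : ℕ) : ℤ) by norm_cast)])
    obtain ⟨ha1, ha2, ha3⟩ := hR.harc a
    refine boxAll_arc_disjoint_rotRows (M := P.M) (lamS := 2 * P.eA + 1) hn1 hns' he (by rw [← hGE]; exact ha1) (by rw [← hGE]; exact ha3)
      (sft_lt _ _) hι2 hι3 (by linarith) ?_ hV.eA_facts.2.2.1 (by linarith) hrows hsec hdep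
    intro g hg1 hg2
    have hex := hR.hexclY a a' hne hl g
    have hlo : (σ.YO P a a').rwlo (σ.nE P a) P.sA (σ.rE P a) =
        blockOff (σ.nE P a) (sft (ts a) (ts a')) + 2 * (latIdx P.sA (σ.rE P a) (σ.tr P a' - P.sA) - 1) := rfl
    have hhi : (σ.YO P a a').rwhi (σ.nE P a) P.sA (σ.rE P a) =
        blockOff (σ.nE P a) (sft (ts a) (ts a')) + 2 * (latIdx P.sA (σ.rE P a) (σ.tr P a' + ((P.dA - 1 : ℕ) : ℤ) * P.sA) + 1) + 1 := rfl
    rw [hlo, hhi, hιs] at hex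
    rw [← hGE]
    exact hex (by omega) (by omega)

/-- **P3. The arc of `a` misses every rotated target strip** (beyond `∂Λ_{4M}`). [folklore] -/
theorem arcs_disjoint_tgtS (hV : P.ValidA) (hR : σ.RouteOK P) (a a' : Fin 4) (j : ℕ) :
    Disjoint (σ.arcs P a) (triRotIsoPow j '' σ.tgtS P a') := by
  obtain ⟨hk1, hk2, hsA, -, -, he1, -, he3, hk₀, -, -, -, r1, -, r3, -⟩ := efacts hV hR a
  obtain ⟨-, hdepth, hdep⟩ := tgtS_facts hV hR a'
  have hμ0 : (0 : ℤ) ≤ P.μ := by positivity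
  have hl0 : (0 : ℤ) ≤ σ.lv a := by positivity
  have he : 2 * P.eA ≤ σ.rE P a := by
    have h1 : (P.μ : ℤ) ≤ (2 * σ.lv a + 1) * P.μ := le_mul_of_one_le_left hμ0 (by linarith)
    have : (2 * P.eA : ℤ) ≤ σ.rE P a := by linarith
    exact_mod_cast this
  refine boxAll_arc_disjoint_of_norm he (norm_image_rot_of_dep (p := fun x => x < (σ.rE P a : ℤ) - P.sA - 2 * P.eA ∨ (σ.rE P a : ℤ) + 2 * P.eA < x)
    hdep fun u hu => Or.inr ?_)
  have := hdepth u hu; omega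

/-- **P4. The arcs of distinct exits are in disjoint norm bands.** [folklore] -/
theorem arcs_disjoint_arcs (hV : P.ValidA) (hR : σ.RouteOK P) {a a' : Fin 4} (hne : a ≠ a') (j : ℕ) :
    Disjoint (σ.arcs P a) (triRotIsoPow j '' σ.arcs P a') := by
  obtain ⟨hk1, hk2, hsA, -, -, he1, -, he3, hk₀, -, -, -, r1, r2, -⟩ := efacts hV hR a
  obtain ⟨-, -, -, -, -, -, -, -, -, -, -, -, r1', r2', -⟩ := efacts hV hR a'
  have hμ0 : (0 : ℤ) ≤ P.μ := by positivity
  have hl0 : (0 : ℤ) ≤ σ.lv a := by positivity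
  have hl0' : (0 : ℤ) ≤ σ.lv a' := by positivity
  have he : 2 * P.eA ≤ σ.rE P a := by
    have h1 : (P.μ : ℤ) ≤ (2 * σ.lv a + 1) * P.μ := le_mul_of_one_le_left hμ0 (by linarith)
    have : (2 * P.eA : ℤ) ≤ σ.rE P a := by linarith
    exact_mod_cast this
  refine boxAll_arc_disjoint_of_norm he (forall_norm_image_rot (p := fun x => x < (σ.rE P a : ℤ) - P.sA - 2 * P.eA ∨ (σ.rE P a : ℤ) + 2 * P.eA < x)
    fun v hv => ?_)
  obtain ⟨n1, n2⟩ := arcs_norm hV hR a' v hv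
  rcases Nat.lt_or_gt_of_ne (hR.hlv_ne a a' hne) with hl | hl
  · right; have hl' : (σ.lv a : ℤ) + 1 ≤ σ.lv a' := by exact_mod_cast hl
    have hμl : (2 * (σ.lv a : ℤ) + 3) * P.μ ≤ (2 * σ.lv a' + 1) * P.μ := mul_le_mul_of_nonneg_right (by linarith) hμ0
    linarith
  · left; have hl' : (σ.lv a' : ℤ) + 1 ≤ σ.lv a := by exact_mod_cast hl
    have hμl : (2 * (σ.lv a' : ℤ) + 3) * P.μ ≤ (2 * σ.lv a + 1) * P.μ := mul_le_mul_of_nonneg_right (by linarith) hμ0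
    linarith

/-- **P5. The spokes of distinct exits are disjoint** (rows on a common side, cones otherwise). [folklore] -/
theorem spk_disjoint_spk (hV : P.ValidA) (hR : σ.RouteOK P) {a a' : Fin 4} (hne : a ≠ a') (δ : ℕ) :
    Disjoint (triRotIsoPow (sft δ (σ.i' a)) '' σ.spk P a) (triRotIsoPow (sft δ (σ.i' a')) '' σ.spk P a') := by
  obtain ⟨hrows, hsec, -⟩ := spk_facts hV hR a
  obtain ⟨hrows', hsec', -⟩ := spk_facts hV hR a'
  have hi6 : σ.i' a < 6 := Nat.mod_lt _ (by norm_num)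
  have hi6' : σ.i' a' < 6 := Nat.mod_lt _ (by norm_num)
  by_cases hi : σ.i a = σ.i a'
  · have hi' : σ.i' a = σ.i' a' := by unfold ASlot.i'; rw [hi]
    rw [hi']
    rcases hR.hspk a a' hne hi with h | h
    · exact disjoint_image_rot_of_rows (y := σ.ξ P a + 2 * P.ε) (fun u hu => (hrows u hu).2) fun u hu => by
        have := (hrows' u hu).1; linarith
    · exact (disjoint_image_rot_of_rows (y := σ.ξ P a' + 2 * P.ε) (fun u hu => (hrows' u hu).2) fun u hu => by
        have := (hrows u hu).1; linarith).symm
  · have hi' : σ.i' a ≠ σ.i' a' := by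
      intro h; apply hi; unfold ASlot.i' at h; have := hR.hi a; have := hR.hi a'; omega
    exact disjoint_image_rot_of_ne (sft_lt _ _) (sft_lt _ _) (fun h => hi' ((sft_inj hi6 hi6').1 h)) hsec hsec'

/-- **P6. A spoke misses the approach strips of the other exits** (danger zones on a common side,
cones otherwise). [folklore] -/
theorem spk_disjoint_apr (hV : P.ValidA) (hR : σ.RouteOK P) (a a' : Fin 4) (δ : ℕ) :
    Disjoint (triRotIsoPow (sft δ (σ.i' a)) '' σ.spk P a) (triRotIsoPow (sft δ (ts a')) '' σ.apr P a') := by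
  obtain ⟨hk1, hk2, hsA, hw, hε1, -⟩ := efacts hV hR a
  obtain ⟨hrows, hsec, -⟩ := spk_facts hV hR a
  obtain ⟨hrows', hsec', -⟩ := apr_facts hV hR a'
  have hi6 : σ.i' a < 6 := Nat.mod_lt _ (by norm_num)
  by_cases hi : σ.i' a = ts a'
  · rw [hi]
    have hμ : (0 : ℤ) ≤ P.μ := by positivity
    have hs0 : (0 : ℤ) ≤ P.sA := by positivity
    have hN : ((P.N' / 64 : ℕ) : ℤ) = ((4 * P.M / 64 : ℕ) : ℤ) := by norm_cast
    rcases hR.htgt a a' hi with h | h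
    · exact disjoint_image_rot_of_rows (y := σ.ξ P a + 2 * P.ε) (fun u hu => (hrows u hu).2) fun u hu => by
        have := (hrows' u hu).1; linarith
    · exact (disjoint_image_rot_of_rows (y := σ.tr P a' + (4 * P.M / 64 : ℕ)) (fun u hu => (hrows' u hu).2) fun u hu => by
        have := (hrows u hu).1; linarith).symm
  · exact disjoint_image_rot_of_ne (sft_lt _ _) (sft_lt _ _) (fun h => hi ((sft_inj hi6 (ts_lt a')).1 h)) hsec hsec'

/-- **P7. A spoke misses every rotated target strip** (it ends before `∂Λ_{4M}`). [folklore] -/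
theorem spk_disjoint_tgtS (hV : P.ValidA) (hR : σ.RouteOK P) (a a' : Fin 4) (i j : ℕ) :
    Disjoint (triRotIsoPow i '' σ.spk P a) (triRotIsoPow j '' σ.tgtS P a') := by
  obtain ⟨hk1, hk2, hsA, hw, hε1, he1, -, he3, hk₀, -, -, -, r1, r2, r3, hL, -, -, -, hμM, -, -, he4, he5⟩ := efacts hV hR a
  obtain ⟨-, -, -, hdepth, -⟩ := spk_facts hV hR a
  obtain ⟨-, hdepth', hdep'⟩ := tgtS_facts hV hR a'
  have hl7 : (σ.lv a : ℤ) ≤ 7 := by have := hR.hlv a; omega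
  have hμ0 : (0 : ℤ) ≤ P.μ := by positivity
  refine disjoint_of_norm (m := 4 * P.M) (norm_image_rot_of_dep (p := fun x => x ≤ 4 * (P.M : ℤ)) (spk_dep hV hR a) fun u hu => ?_)
    (norm_image_rot_of_dep (p := fun x => 4 * (P.M : ℤ) < x) hdep' fun u hu => by have := hdepth' u hu; omega)
  obtain ⟨d1, d2⟩ := hdepth u hu
  have hμl : (2 * (σ.lv a : ℤ) + 1) * P.μ ≤ 15 * P.μ := mul_le_mul_of_nonneg_right (by linarith) hμ0
  show u 0 ≤ _
  linarith

/-- **P8. Strips of distinct exits are in different cones.** [folklore] -/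
theorem strips_disjoint (hV : P.ValidA) (hR : σ.RouteOK P) {a a' : Fin 4} (hne : a ≠ a') (δ : ℕ) :
    Disjoint (triRotIsoPow (sft δ (ts a)) '' (σ.apr P a ∪ σ.tgtS P a)) (triRotIsoPow (sft δ (ts a')) '' (σ.apr P a' ∪ σ.tgtS P a')) := by
  obtain ⟨-, hsec, -⟩ := apr_facts hV hR a
  obtain ⟨-, hsec', -⟩ := apr_facts hV hR a'
  obtain ⟨tsec, -⟩ := tgtS_facts hV hR a
  obtain ⟨tsec', -⟩ := tgtS_facts hV hR a'
  refine disjoint_image_rot_of_ne (sft_lt _ _) (sft_lt _ _) (fun h => ts_ne hne ((sft_inj (ts_lt a) (ts_lt a')).1 h)) ?_ ?_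
  · rintro u (hu | hu); exacts [hsec u hu, tsec u hu]
  · rintro u (hu | hu); exacts [hsec' u hu, tsec' u hu]

/-- **P9. The exterior footprint of `a` misses the spoke of `a' ≠ a`** (rows on a common side, cones otherwise). [folklore] -/
theorem zone_disjoint_spk (hV : P.ValidA) (hR : σ.RouteOK P) {a a' : Fin 4} (hne : a ≠ a') (δ : ℕ) :
    Disjoint (triRotIsoPow (sft δ (σ.i' a)) '' σ.zone P a) (triRotIsoPow (sft δ (σ.i' a')) '' σ.spk P a') := by
  obtain ⟨zsec, -, zrows, -⟩ := zone_facts hV hR a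
  obtain ⟨hrows', hsec', -⟩ := spk_facts hV hR a'
  have hi6 : σ.i' a < 6 := Nat.mod_lt _ (by norm_num)
  have hi6' : σ.i' a' < 6 := Nat.mod_lt _ (by norm_num)
  by_cases hi : σ.i a = σ.i a'
  · have hi' : σ.i' a = σ.i' a' := by unfold ASlot.i'; rw [hi]
    rw [hi']
    rcases hR.hrows a a' hne hi with h | h
    · exact disjoint_image_rot_of_rows (y := σ.T P a + P.w + 3 * σ.k P a - 1) (fun u hu => by have := (zrows u hu).2; omega)
        fun u hu => by have := (hrows' u hu).1; omega
    · exact (disjoint_image_rot_of_rows (y := σ.ξ P a' + 2 * P.ε) (fun u hu => (hrows' u hu).2) fun u hu => by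
        have := (zrows u hu).1; omega).symm
  · have hi' : σ.i' a ≠ σ.i' a' := by
      intro h; apply hi; unfold ASlot.i' at h; have := hR.hi a; have := hR.hi a'; omega
    exact disjoint_image_rot_of_ne (sft_lt _ _) (sft_lt _ _) (fun h => hi' ((sft_inj hi6 hi6').1 h)) zsec hsec'

/-- **P9'. The exterior footprint of `a` lies below every ring, approach strip and target strip.** [folklore] -/
theorem zone_disjoint_far (hV : P.ValidA) (hR : σ.RouteOK P) (a a' : Fin 4) (i j : ℕ) :
    Disjoint (triRotIsoPow i '' σ.zone P a) (triRotIsoPow j '' (σ.arcs P a' ∪ σ.apr P a' ∪ σ.tgtS P a')) := by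
  obtain ⟨hk1, hk2, hsA, hw, hε1, he1, -, he3, hk₀, -⟩ := efacts hV hR a
  obtain ⟨-, -, -, -, -, -, -, -, -, -, -, -, r1', r2', r3', -, -, -, -, hμM, -⟩ := efacts hV hR a'
  obtain ⟨-, znorm, -⟩ := zone_facts hV hR a
  obtain ⟨-, -, -, hdepth', -⟩ := apr_facts hV hR a'
  obtain ⟨-, tdepth', tdep'⟩ := tgtS_facts hV hR a'
  have hμ0 : (0 : ℤ) ≤ P.μ := by positivity
  have hl0' : (0 : ℤ) ≤ σ.lv a' := by positivity
  refine disjoint_of_norm (m := 2 * P.M + 2 * σ.k P a + 1) (forall_norm_image_rot (p := fun x => x ≤ 2 * (P.M : ℤ) + 2 * σ.k P a + 1) znorm)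
    (forall_norm_image_rot (p := fun x => 2 * (P.M : ℤ) + 2 * σ.k P a + 1 < x) ?_)
  have hμ1 : (P.μ : ℤ) ≤ (2 * σ.lv a' + 1) * P.μ := le_mul_of_one_le_left hμ0 (by linarith)
  rintro v ((hv | hv) | hv)
  · have := (arcs_norm hV hR a' v hv).1
    show _ < triNorm v
    linarith
  · obtain ⟨d0, d1, d1'⟩ := apr_dep hV hR a' v hv
    have hn : triNorm v = v 0 := le_antisymm (triNorm_le_iff_lin.2 (by omega)) (le_triNorm_iff_lin.2 (Or.inl le_rfl))
    show _ < triNorm v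
    rw [hn]; have := hdepth' v hv; linarith
  · obtain ⟨d0, d1, d1'⟩ := tdep' v hv
    have hn : triNorm v = v 0 := le_antisymm (triNorm_le_iff_lin.2 (by omega)) (le_triNorm_iff_lin.2 (Or.inl le_rfl))
    show _ < triNorm v
    rw [hn]; have := tdepth' v hv; linarith

/-- **P10. `Λ_{2M}` lies below every spoke, ring, approach strip and target strip.** [folklore] -/
theorem ball_disjoint_far (hV : P.ValidA) (hR : σ.RouteOK P) (a' : Fin 4) (i j : ℕ) :
    Disjoint {v : Site 2 | triNorm v ≤ 2 * P.M}
      (triRotIsoPow i '' σ.spk P a' ∪ triRotIsoPow j '' (σ.arcs P a' ∪ σ.apr P a' ∪ σ.tgtS P a')) := by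
  obtain ⟨hk1, hk2, hsA, hw, hε1, he1, -, he3, hk₀, -, -, -, r1', r2', r3', -, -, -, -, hμM, -⟩ := efacts hV hR a'
  obtain ⟨-, -, -, hdepth, -⟩ := spk_facts hV hR a'
  obtain ⟨-, -, -, hdepth', -⟩ := apr_facts hV hR a'
  obtain ⟨-, tdepth', tdep'⟩ := tgtS_facts hV hR a'
  have hμ0 : (0 : ℤ) ≤ P.μ := by positivity
  have hl0' : (0 : ℤ) ≤ σ.lv a' := by positivity
  refine disjoint_of_norm (m := 2 * P.M) (fun v hv => hv) ?_
  rintro v (hv | hv)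
  · exact norm_image_rot_of_dep (p := fun x => 2 * (P.M : ℤ) < x) (spk_dep hV hR a') (fun u hu => by have := (hdepth u hu).1; linarith) v hv
  · refine forall_norm_image_rot (p := fun x => 2 * (P.M : ℤ) < x) ?_ v hv
    have hμ1 : (P.μ : ℤ) ≤ (2 * σ.lv a' + 1) * P.μ := le_mul_of_one_le_left hμ0 (by linarith)
    rintro v ((hv | hv) | hv)
    · have := (arcs_norm hV hR a' v hv).1
      show _ < triNorm v
      linarith
    · obtain ⟨d0, d1, d1'⟩ := apr_dep hV hR a' v hv
      have hn : triNorm v = v 0 := le_antisymm (triNorm_le_iff_lin.2 (by omega)) (le_triNorm_iff_lin.2 (Or.inl le_rfl))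
      show _ < triNorm v
      rw [hn]; have := hdepth' v hv; linarith
    · obtain ⟨d0, d1, d1'⟩ := tdep' v hv
      have hn : triNorm v = v 0 := le_antisymm (triNorm_le_iff_lin.2 (by omega)) (le_triNorm_iff_lin.2 (Or.inl le_rfl))
      rw [hn]; have := tdepth' v hv; omega

/-! ### Rotating images -/

/-- Images through `ρ^0`. [folklore] -/
theorem image_rot_zero (X : Set (Site 2)) : triRotIsoPow 0 '' X = X := by
  ext v; simp

/-- Images through `ρ^m` depend on `m % 6`. [folklore] -/
theorem image_rot_mod (m : ℕ) (X : Set (Site 2)) : triRotIsoPow m '' X = triRotIsoPow (m % 6) '' X := by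
  ext v; constructor <;> rintro ⟨u, hu, rfl⟩ <;> refine ⟨u, hu, ?_⟩ <;> rw [triRotIsoPow_mod_six_apply]

/-- Composing images of rotations. [folklore] -/
theorem image_rot_image_rot (i j : ℕ) (X : Set (Site 2)) :
    triRotIsoPow i '' (triRotIsoPow j '' X) = triRotIsoPow (j + i) '' X := by
  rw [Set.image_image]; exact Set.image_congr fun u _ => (triRotIsoPow_add_apply j i u).symm

/-- Disjointness of rotated images is invariant under a common further rotation. [folklore] -/
theorem disjoint_rot_shift {i j : ℕ} {X Y : Set (Site 2)} (c : ℕ) (h : Disjoint (triRotIsoPow i '' X) (triRotIsoPow j '' Y)) :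
    Disjoint (triRotIsoPow (i + c) '' X) (triRotIsoPow (j + c) '' Y) := by
  rw [← image_rot_image_rot c i, ← image_rot_image_rot c j]
  exact (Set.disjoint_image_iff (triRotIsoPow c).injective).2 h

/-- Disjointness with exponents taken modulo `6`. [folklore] -/
theorem disjoint_rot_congr {i j i' j' : ℕ} {X Y : Set (Site 2)} (hi : i % 6 = i' % 6) (hj : j % 6 = j' % 6)
    (h : Disjoint (triRotIsoPow i '' X) (triRotIsoPow j '' Y)) : Disjoint (triRotIsoPow i' '' X) (triRotIsoPow j' '' Y) := by
  rw [image_rot_mod i, hi, ← image_rot_mod] at h; rw [image_rot_mod j, hj, ← image_rot_mod] at h; exact h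

/-! ### The sides of the two exits of one colour in the reading configuration -/

/-- **Sides of the exits of one colour in the reading ring of the first**: the reading rotation is
`r + ts (ex b 0)`, so the exit `ex b q` sits on the side `sft (ts (ex b 0)) (i' (ex b q))`, which is
`iR b q`; and `ts (ex b 1) = ts (ex b 0) + 1`. [folklore] -/
theorem iR_facts (hR : σ.RouteOK P) (b : Bool) :
    σ.iR b 0 = sft (ts (ex b 0)) (σ.i' (ex b 0)) ∧ σ.iR b 1 = sft (ts (ex b 0)) (σ.i' (ex b 1)) ∧
      sft (ts (ex b 0)) (ts (ex b 0)) = 0 ∧ sft (ts (ex b 0)) (ts (ex b 1)) = 1 ∧ sft (ts (ex b 1)) (ts (ex b 0)) = 5 ∧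
      ((σ.iR b 1 + 5) % 6 + 1) % 6 = σ.iR b 1 ∧ σ.iR b 0 < 6 ∧ σ.iR b 1 < 6 ∧
      (sft (ts (ex b 1)) (σ.i' (ex b 0)) + 1) % 6 = σ.iR b 0 ∧
      (σ.iR b 0 + σ.rot b) % 6 = σ.i (ex b 0) ∧ ((σ.iR b 1 + 5) % 6 + 1 + σ.rot b) % 6 = σ.i (ex b 1) ∧ σ.rot b < 6 ∧
      (σ.i (ex b 0) + (6 - σ.rot b)) % 6 = σ.iR b 0 ∧ (σ.i (ex b 1) + (6 - σ.rot b)) % 6 = σ.iR b 1 := by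
  have h0 := hR.hi 0; have h1 := hR.hi 1; have h2 := hR.hi 2; have h3 := hR.hi 3
  obtain ⟨t0, t1, t2, t3⟩ := ts_val
  unfold ASlot.iR ASlot.rot ASlot.i' sft
  cases b
  · have e0 : ex false 0 = 2 := rfl
    have e1 : ex false 1 = 3 := rfl
    rw [e0, e1, t2, t3]
    simp only [Bool.false_eq_true, ↓reduceIte, true_and]
    omega
  · have e0 : ex true 0 = 0 := rfl
    have e1 : ex true 1 = 1 := rfl
    rw [e0, e1, t0, t1]
    simp only [↓reduceIte, true_and]
    omega

/-! ### The near set of an exit -/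

/-- **The near part of the region of an exit lies in `Λ_{2M}` and the exterior footprint**: the route
is tight outside `Λ_{2M}` and the corner box sits in the footprint. [folklore] -/
theorem near_subset (hV : P.ValidA) (hR : σ.RouteOK P) (a : Fin 4) {S : Set (Site 2)} {z : Site 2} {k : ℕ} (i : ℕ)
    (hk : k = σ.k P a) (hz : z 0 = 2 * (P.M : ℤ)) (hwin : σ.T P a ≤ z 1 ∧ z 1 < σ.T P a + P.w)
    (hS : ∀ u ∈ S, 2 * (P.M : ℤ) < triNorm u → ExitTight z k u) :
    triRotIsoPow i '' (S ∪ triStrip (z 0 + k) (z 1 + k) k k) ⊆ {v | triNorm v ≤ 2 * (P.M : ℤ)} ∪ triRotIsoPow i '' σ.zone P a := by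
  subst hk
  obtain ⟨hk1, hk2, hsA, hw, -, -, -, -, hk₀, -, -, -, -, -, -, -, -, -, -, hμM, hR₀, -⟩ := efacts hV hR a
  obtain ⟨T1, T2⟩ := hR.hT a
  rintro v ⟨u, hu, rfl⟩
  rcases hu with hu | hu
  · by_cases hn : triNorm u ≤ 2 * (P.M : ℤ)
    · left; show triNorm (triRotIsoPow i u) ≤ _; rw [triNorm_rot]; exact hn
    · right
      push Not at hn
      obtain ⟨t1, t2, t3, t4⟩ := hS u hu hn
      refine ⟨u, ⟨?_, by omega, by omega, by omega⟩, rfl⟩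
      by_contra h0
      push Not at h0
      have : triNorm u ≤ 2 * (P.M : ℤ) := triNorm_le_iff_lin.2 (by omega)
      omega
  · right
    rw [mem_triStrip] at hu
    exact ⟨u, ⟨by omega, by omega, by omega, by omega⟩, rfl⟩

/-! ### The two regions of one colour are disjoint -/

/-- **The regions of the two exits of one colour are disjoint** (the hypothesis `hdisj` of
`extOpenDuoR_of_exits'`): near sets by hypothesis (the two structures are disjoint) and by the
footprints, everything else by the pair lemmas. [cite: Nolin2008, §4.3 Prop. 12, Lemma 13, §4.4 (arXiv 0711.4948: Prop. 11, Lemma 12; proof of Thm. 10), σ = BBWW] -/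
theorem regions_disjoint (hV : P.ValidA) (hR : σ.RouteOK P) (b : Bool) {S₀ S₁ : Set (Site 2)} {z₀ z₁ : Site 2} {k₀ k₁ : ℕ}
    (hk₀ : k₀ = σ.k P (ex b 0)) (hk₁ : k₁ = σ.k P (ex b 1)) (hz₀ : z₀ 0 = 2 * (P.M : ℤ)) (hz₁ : z₁ 0 = 2 * (P.M : ℤ))
    (hw₀ : σ.T P (ex b 0) ≤ z₀ 1 ∧ z₀ 1 < σ.T P (ex b 0) + P.w) (hw₁ : σ.T P (ex b 1) ≤ z₁ 1 ∧ z₁ 1 < σ.T P (ex b 1) + P.w)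
    (ht₀ : ∀ u ∈ S₀, 2 * (P.M : ℤ) < triNorm u → ExitTight z₀ k₀ u) (ht₁ : ∀ u ∈ S₁, 2 * (P.M : ℤ) < triNorm u → ExitTight z₁ k₁ u)
    (hdisj : Disjoint (triRotIsoPow (σ.iR b 0) '' (S₀ ∪ triStrip (z₀ 0 + k₀) (z₀ 1 + k₀) k₀ k₀))
      (triRotIsoPow (σ.iR b 1) '' (S₁ ∪ triStrip (z₁ 0 + k₁) (z₁ 1 + k₁) k₁ k₁))) :
    Disjoint
      (rowRegion (σ.iR b 0) P.M S₀ z₀ k₀ (σ.T P (ex b 0)) P.w (σ.L P (ex b 0)) P.ε (σ.rE P (ex b 0)) P.eA P.sA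
        (σ.ast (ex b 0)) (σ.aln (ex b 0)) (σ.tr P (ex b 0)) (σ.W P (ex b 0)))
      (triRotIsoPow 1 '' rowRegion ((σ.iR b 1 + 5) % 6) P.M S₁ z₁ k₁ (σ.T P (ex b 1)) P.w (σ.L P (ex b 1)) P.ε (σ.rE P (ex b 1))
        P.eA P.sA (σ.ast (ex b 1)) (σ.aln (ex b 1)) (σ.tr P (ex b 1)) (σ.W P (ex b 1))) := by
  obtain ⟨i0, i1, s00, s01, s10, haR, hi0, hi1, hsp, -⟩ := iR_facts hR b
  have hne : ex b 0 ≠ ex b 1 := by unfold ex; cases b <;> simp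
  -- names
  set a₀ := ex b 0 with ha₀
  set a₁ := ex b 1 with ha₁
  set N₀ := triRotIsoPow (σ.iR b 0) '' (S₀ ∪ triStrip (z₀ 0 + k₀) (z₀ 1 + k₀) k₀ k₀) with hN₀
  set N₁ := triRotIsoPow (σ.iR b 1) '' (S₁ ∪ triStrip (z₁ 0 + k₁) (z₁ 1 + k₁) k₁ k₁) with hN₁
  set K₀ := triRotIsoPow (σ.iR b 0) '' σ.spk P a₀ with hK₀
  set K₁ := triRotIsoPow (σ.iR b 1) '' σ.spk P a₁ with hK₁
  set F₀ := σ.arcs P a₀ ∪ σ.apr P a₀ ∪ σ.tgtS P a₀ with hF₀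
  set F₁ := σ.arcs P a₁ ∪ σ.apr P a₁ ∪ σ.tgtS P a₁ with hF₁
  set B : Set (Site 2) := {v | triNorm v ≤ 2 * (P.M : ℤ)} with hB
  -- the two regions inside `N ∪ K ∪ F`
  have hsub₀ : rowRegion (σ.iR b 0) P.M S₀ z₀ k₀ (σ.T P a₀) P.w (σ.L P a₀) P.ε (σ.rE P a₀) P.eA P.sA (σ.ast a₀) (σ.aln a₀) (σ.tr P a₀) (σ.W P a₀)
      ⊆ N₀ ∪ K₀ ∪ F₀ := by
    subst hk₀
    rintro v (⟨u, hu, rfl⟩ | hv)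
    · rcases hu with hu | hu
      · exact Or.inl (Or.inl ⟨u, hu, rfl⟩)
      · exact Or.inl (Or.inr ⟨u, hu, rfl⟩)
    · exact Or.inr hv
  have hsub₁ : triRotIsoPow 1 '' rowRegion ((σ.iR b 1 + 5) % 6) P.M S₁ z₁ k₁ (σ.T P a₁) P.w (σ.L P a₁) P.ε (σ.rE P a₁) P.eA P.sA
      (σ.ast a₁) (σ.aln a₁) (σ.tr P a₁) (σ.W P a₁) ⊆ N₁ ∪ K₁ ∪ triRotIsoPow 1 '' F₁ := by
    subst hk₁
    rintro v ⟨w, hw, rfl⟩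
    rcases hw with ⟨u, hu, rfl⟩ | hw
    · have e : triRotIsoPow 1 (triRotIsoPow ((σ.iR b 1 + 5) % 6) u) = triRotIsoPow (σ.iR b 1) u := by
        rw [← triRotIsoPow_add_apply, ← triRotIsoPow_mod_six_apply, haR]
      rw [e]
      rcases hu with hu | hu
      · exact Or.inl (Or.inl ⟨u, hu, rfl⟩)
      · exact Or.inl (Or.inr ⟨u, hu, rfl⟩)
    · exact Or.inr ⟨w, hw, rfl⟩
  refine Disjoint.mono hsub₀ hsub₁ ?_
  -- near sets inside the ball and the footprints
  have hn₀ : N₀ ⊆ B ∪ triRotIsoPow (σ.iR b 0) '' σ.zone P a₀ := near_subset hV hR a₀ _ hk₀ hz₀ hw₀ ht₀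
  have hn₁ : N₁ ⊆ B ∪ triRotIsoPow (σ.iR b 1) '' σ.zone P a₁ := near_subset hV hR a₁ _ hk₁ hz₁ hw₁ ht₁
  -- the far pieces of `a₁`, rotated once
  have hF₁' : triRotIsoPow 1 '' F₁ = triRotIsoPow 1 '' σ.arcs P a₁ ∪ triRotIsoPow 1 '' σ.apr P a₁ ∪ triRotIsoPow 1 '' σ.tgtS P a₁ := by
    rw [hF₁, Set.image_union, Set.image_union]
  -- ball and footprints against everything far
  have bK₁ : Disjoint B K₁ := (ball_disjoint_far hV hR a₁ (σ.iR b 1) 1).mono_right Set.subset_union_left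
  have bF₁ : Disjoint B (triRotIsoPow 1 '' F₁) := (ball_disjoint_far hV hR a₁ (σ.iR b 1) 1).mono_right Set.subset_union_right
  have bK₀ : Disjoint B K₀ := (ball_disjoint_far hV hR a₀ (σ.iR b 0) 0).mono_right Set.subset_union_left
  have bF₀ : Disjoint B F₀ := by
    have h := (ball_disjoint_far hV hR a₀ (σ.iR b 0) 0).mono_right Set.subset_union_right
    rwa [image_rot_zero] at h
  have zK₁ : Disjoint (triRotIsoPow (σ.iR b 0) '' σ.zone P a₀) K₁ := by
    have h := zone_disjoint_spk hV hR hne (ts a₀); rwa [← i0, ← i1] at h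
  have zK₀ : Disjoint (triRotIsoPow (σ.iR b 1) '' σ.zone P a₁) K₀ := by
    have h := zone_disjoint_spk hV hR (Ne.symm hne) (ts a₀); rwa [← i0, ← i1] at h
  have zF₁ : Disjoint (triRotIsoPow (σ.iR b 0) '' σ.zone P a₀) (triRotIsoPow 1 '' F₁) := zone_disjoint_far hV hR a₀ a₁ _ 1
  have zF₀ : Disjoint (triRotIsoPow (σ.iR b 1) '' σ.zone P a₁) F₀ := by
    have h := zone_disjoint_far hV hR a₁ a₀ (σ.iR b 1) 0; rwa [image_rot_zero] at h
  have NK : Disjoint N₀ K₁ := (Set.disjoint_union_left.2 ⟨bK₁, zK₁⟩).mono_left hn₀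
  have NF : Disjoint N₀ (triRotIsoPow 1 '' F₁) := (Set.disjoint_union_left.2 ⟨bF₁, zF₁⟩).mono_left hn₀
  have KN : Disjoint K₀ N₁ := ((Set.disjoint_union_left.2 ⟨bK₀, zK₀⟩).mono_left hn₁).symm
  have FN : Disjoint F₀ N₁ := ((Set.disjoint_union_left.2 ⟨bF₀, zF₀⟩).mono_left hn₁).symm
  -- spokes against spokes and far pieces
  have KK : Disjoint K₀ K₁ := by
    have h := spk_disjoint_spk hV hR hne (ts a₀); rwa [← i0, ← i1] at h
  have KF : Disjoint K₀ (triRotIsoPow 1 '' F₁) := by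
    rw [hF₁']
    refine Set.disjoint_union_right.2 ⟨Set.disjoint_union_right.2 ⟨?_, ?_⟩, spk_disjoint_tgtS hV hR a₀ a₁ _ 1⟩
    · -- the arc of `a₁` against the spoke of `a₀`: in the ring of `a₁`, then rotate once
      have h := arcs_disjoint_spk hV hR (Ne.symm hne)
      rw [← image_rot_zero (σ.arcs P a₁)] at h
      have h' := disjoint_rot_shift 1 h
      exact (disjoint_rot_congr (i := 0 + 1) (j := sft (ts a₁) (σ.i' a₀) + 1) (i' := 1) (j' := σ.iR b 0) (by norm_num)
        (by rw [hsp, Nat.mod_eq_of_lt hi0]) h').symm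
    · have h := spk_disjoint_apr hV hR a₀ a₁ (ts a₀); rwa [← i0, s01] at h
  have FK : Disjoint F₀ K₁ := by
    refine Set.disjoint_union_left.2 ⟨Set.disjoint_union_left.2 ⟨?_, ?_⟩, ?_⟩
    · have h := arcs_disjoint_spk hV hR hne; rwa [← i1] at h
    · have h := spk_disjoint_apr hV hR a₁ a₀ (ts a₀); rw [← i1, s00, image_rot_zero] at h; exact h.symm
    · have h := spk_disjoint_tgtS hV hR a₁ a₀ (σ.iR b 1) 0; rw [image_rot_zero] at h; exact h.symm
  -- far pieces against far pieces
  have FF : Disjoint F₀ (triRotIsoPow 1 '' F₁) := by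
    rw [hF₁']
    refine Set.disjoint_union_left.2 ⟨Set.disjoint_union_left.2 ⟨?_, ?_⟩, ?_⟩
    · -- the arc of `a₀`
      refine Set.disjoint_union_right.2 ⟨Set.disjoint_union_right.2 ⟨arcs_disjoint_arcs hV hR hne 1, ?_⟩, arcs_disjoint_tgtS hV hR a₀ a₁ 1⟩
      have h := arcs_disjoint_apr hV hR hne; rwa [s01] at h
    · -- the approach strip of `a₀`
      refine Set.disjoint_union_right.2 ⟨Set.disjoint_union_right.2 ⟨?_, ?_⟩, ?_⟩
      · have h := arcs_disjoint_apr hV hR (Ne.symm hne)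
        rw [s10, ← image_rot_zero (σ.arcs P a₁)] at h
        have h' := disjoint_rot_shift 1 h
        have h'' := disjoint_rot_congr (i := 0 + 1) (j := 5 + 1) (i' := 1) (j' := 0) (by norm_num) (by norm_num) h'
        rw [image_rot_zero] at h''; exact h''.symm
      · have h := strips_disjoint hV hR hne (ts a₀)
        rw [s00, s01, image_rot_zero] at h
        exact (h.mono_left Set.subset_union_left).mono_right (Set.image_mono Set.subset_union_left)
      · have h := strips_disjoint hV hR hne (ts a₀)
        rw [s00, s01, image_rot_zero] at h
        exact (h.mono_left Set.subset_union_left).mono_right (Set.image_mono Set.subset_union_right)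
    · -- the target strip of `a₀`
      refine Set.disjoint_union_right.2 ⟨Set.disjoint_union_right.2 ⟨?_, ?_⟩, ?_⟩
      · have h := arcs_disjoint_tgtS hV hR a₁ a₀ 5
        rw [← image_rot_zero (σ.arcs P a₁)] at h
        have h' := disjoint_rot_shift 1 h
        have h'' := disjoint_rot_congr (i := 0 + 1) (j := 5 + 1) (i' := 1) (j' := 0) (by norm_num) (by norm_num) h'
        rw [image_rot_zero] at h''; exact h''.symm
      · have h := strips_disjoint hV hR hne (ts a₀)
        rw [s00, s01, image_rot_zero] at h
        exact (h.mono_left Set.subset_union_right).mono_right (Set.image_mono Set.subset_union_left)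
      · have h := strips_disjoint hV hR hne (ts a₀)
        rw [s00, s01, image_rot_zero] at h
        exact (h.mono_left Set.subset_union_right).mono_right (Set.image_mono Set.subset_union_right)
  exact Set.disjoint_union_left.2 ⟨Set.disjoint_union_left.2
    ⟨Set.disjoint_union_right.2 ⟨Set.disjoint_union_right.2 ⟨hdisj, NK⟩, NF⟩,
     Set.disjoint_union_right.2 ⟨Set.disjoint_union_right.2 ⟨KN, KK⟩, KF⟩⟩,
    Set.disjoint_union_right.2 ⟨Set.disjoint_union_right.2 ⟨FN, FK⟩, FF⟩⟩

/-! ### The move -/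

/-- A numeric fact of the exit run: `N'/64 + 2 sA + 1 ≤ dA sA`. [folklore] -/
theorem dA_mul (hV : P.ValidA) : ((P.N' / 64 : ℕ) : ℤ) + 2 * P.sA + 1 ≤ (P.dA : ℤ) * P.sA := by
  obtain ⟨d1, d2⟩ := hV.dA_facts
  have hsA16 := hV.sA_facts.2
  have h1 : 1 ≤ P.dA := by unfold OParams.dA; exact (show 1 ≤ 3 by norm_num).trans (Nat.le_add_left 3 _)
  have : ((P.dA - 1 : ℕ) : ℤ) = (P.dA : ℤ) - 1 := by omega
  rw [this] at d1
  have hk : 1 ≤ P.sA := by omega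
  have h3 := Nat.lt_div_mul_add (a := P.N' / 64) hk
  have hd : (P.dA : ℤ) = (P.N' / 64 / P.sA : ℕ) + 3 := by unfold OParams.dA; push_cast; ring
  rw [hd]
  have : ((P.N' / 64 : ℕ) : ℤ) < ((P.N' / 64 / P.sA : ℕ) : ℤ) * P.sA + P.sA := by exact_mod_cast h3
  nlinarith

/-- **One exit: the hypotheses of `extOpenArm_inter_rowRegion'`** from the corridor event of a routed
slot, for an exit over the side `i` of the configuration `χ` with `i = sft (ts a) (i' a)` (the reading
side of the exit `a`). Packaged as the membership in `extOpenArm` of `χ ∩ rowRegion …` is not needed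
here; we only record the numeric side conditions. [folklore] -/
theorem exit_conditions (hV : P.ValidA) (hR : σ.RouteOK P) (a : Fin 4) :
    4 * σ.k P a + 2 ≤ P.R₀ ∧ 2 * (σ.k P a : ℤ) + 1 ≤ P.M ∧ -(2 * (P.M : ℤ)) ≤ σ.T P a ∧
      (P.w : ℤ) + (σ.k P a / 4 : ℕ) + 2 * P.ε ≤ σ.k P a ∧ σ.k P a + 1 ≤ σ.L P a ∧ 1 ≤ P.sA ∧ P.sA ∣ σ.rE P a ∧ P.sA ≤ σ.rE P a ∧
      2 * P.eA ≤ σ.rE P a ∧ (σ.k P a : ℤ) + σ.L P a ≤ 2 * P.M ∧ 2 * (P.M : ℤ) < (σ.rE P a : ℤ) - P.sA - 2 * P.eA ∧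
      (σ.rE P a : ℤ) + 2 * P.eA ≤ 4 * P.M ∧ σ.rE P a / P.sA = σ.nE P a ∧
      2 * (P.M : ℤ) + σ.k P a + P.sA + 2 * P.ε + P.eA ≤ σ.rE P a ∧ (σ.rE P a : ℤ) + P.eA ≤ 2 * P.M + σ.k P a + σ.L P a ∧
      σ.x P a + P.dA < σ.nE P a ∧
      -(σ.rE P a : ℤ) + σ.x P a * P.sA - P.eA ≤ σ.tr P a ∧
      σ.tr P a + (4 * P.M / 64 : ℕ) ≤ -(σ.rE P a : ℤ) + (σ.x P a + P.dA) * P.sA - P.eA := by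
  obtain ⟨hk1, hk2, hsA, hw, hε1, he1, he0, he3, hk₀, hns, hn1, hGE, r1, r2, r3, hL, hW, ⟨x1, x2⟩, hn, hμM, hR₀, hR₀M, he4, he5⟩ :=
    efacts hV hR a
  obtain ⟨T1, T2⟩ := hR.hT a
  obtain ⟨-, -, -, -, -, t1, t2⟩ := apr_facts hV hR a
  have hsA16 := hV.sA_facts.2
  have hs1 : 1 ≤ P.sA := by omega
  have hμ0 : (0 : ℤ) ≤ P.μ := by positivity
  have hl0 : (0 : ℤ) ≤ σ.lv a := by positivity
  have hl7 : (σ.lv a : ℤ) ≤ 7 := by have := hR.hlv a; omega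
  have hμ1 : (P.μ : ℤ) ≤ (2 * σ.lv a + 1) * P.μ := le_mul_of_one_le_left hμ0 (by linarith)
  have hμ15 : (2 * (σ.lv a : ℤ) + 1) * P.μ ≤ 15 * P.μ := mul_le_mul_of_nonneg_right (by linarith) hμ0
  have hk4 : 4 * ((σ.k P a / 4 : ℕ) : ℤ) ≤ σ.k P a := by omega
  have hns' : σ.nE P a * P.sA = σ.rE P a := by exact_mod_cast hns
  have hdiv : P.sA ∣ σ.rE P a := ⟨σ.nE P a, by rw [← hns', mul_comm]⟩
  have hq : σ.rE P a / P.sA = σ.nE P a := by rw [← hns', Nat.mul_div_cancel _ hs1]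
  -- the exit run
  have hs0 : (0 : ℤ) ≤ P.sA := by positivity
  have hM2 : (2 * P.M : ℤ) ≤ σ.rE P a := by linarith
  have htr : -(σ.rE P a : ℤ) ≤ σ.tr P a := by linarith
  have hx := latIdx_spec (s := P.sA) (r := σ.rE P a) hs1 htr
  have hdA := dA_mul hV
  have hN4 : ((4 * P.M / 64 : ℕ) : ℤ) = ((P.N' / 64 : ℕ) : ℤ) := by norm_cast
  have hN64 : ((P.N' / 64 : ℕ) : ℤ) ≤ P.M := by have : P.N' = 4 * P.M := rfl; omega
  have hxd : σ.x P a + P.dA < σ.nE P a := by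
    have hdd : (P.dA : ℤ) * P.sA ≤ (P.N' / 64 : ℕ) + 4 * P.sA := by
      obtain ⟨-, d2⟩ := hV.dA_facts
      have h1 : 1 ≤ P.dA := by unfold OParams.dA; exact (show 1 ≤ 3 by norm_num).trans (Nat.le_add_left 3 _)
      have : ((P.dA - 1 : ℕ) : ℤ) = (P.dA : ℤ) - 1 := by omega
      rw [this] at d2; linarith
    have hm : ((P.dA + 1 : ℕ) : ℤ) * P.sA = (P.dA : ℤ) * P.sA + P.sA := by push_cast; ring
    have h16 : 4 * (P.M : ℤ) ≤ 16 * ((4 * P.M / 16 : ℕ) : ℤ) + 15 := by omega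
    have hlt : σ.tr P a + ((P.dA + 1 : ℕ) : ℤ) * P.sA < 0 := by rw [hm]; linarith
    have h := latIdx_add_lt (s := P.sA) (r := σ.rE P a) (n := σ.nE P a) (m := P.dA + 1) hs1 hns htr hlt
    unfold ASlot.x; omega
  have c1 : 4 * σ.k P a + 2 ≤ P.R₀ := by
    have : 4 * (σ.k P a : ℤ) + 2 ≤ P.R₀ := by linarith
    exact_mod_cast this
  have c2 : 2 * (σ.k P a : ℤ) + 1 ≤ P.M := by linarith
  have c3 : -(2 * (P.M : ℤ)) ≤ σ.T P a := by linarith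
  have c4 : (P.w : ℤ) + (σ.k P a / 4 : ℕ) + 2 * P.ε ≤ σ.k P a := by linarith
  have c5 : σ.k P a + 1 ≤ σ.L P a := by
    have : (σ.k P a : ℤ) + 1 ≤ σ.L P a := by linarith
    exact_mod_cast this
  have c6 : P.sA ≤ σ.rE P a := by
    have : (P.sA : ℤ) ≤ σ.rE P a := by linarith
    exact_mod_cast this
  have c7 : 2 * P.eA ≤ σ.rE P a := by
    have : (2 * P.eA : ℤ) ≤ σ.rE P a := by linarith
    exact_mod_cast this
  refine ⟨c1, c2, c3, c4, c5, hs1, hdiv, c6, c7, by linarith, by linarith, by linarith, hq, by linarith, by linarith, hxd, ?_, ?_⟩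
  · unfold ASlot.x; linarith [hx.1]
  · unfold ASlot.x
    rw [add_mul, hN4]
    have he' : (P.eA : ℤ) ≤ P.sA := by exact_mod_cast hV.eA_facts.2.2.2.2.1
    linarith [hx.2]

/-- **The move.** For a valid adjacent rung and a routed slot, on the exits event and the corridors
event of the colour `b` the reading configuration of that colour carries two disjoint open arms from
`∂Λ_n` landed on the consecutive sides `0, 1` of `∂Λ_{4M}`:
`armsE b ∩ corrE b ⊆ {readCfg b ω ∈ extOpenDuoR n (4M)}`. [cite: Nolin2008, §4.3 Prop. 12 and §4.4 (arXiv 0711.4948: Prop. 11; proof of Thm. 10, p. 12–13), σ = BBWW] -/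
theorem move (hV : P.ValidA) (hR : σ.RouteOK P) (b : Bool) {ω : SiteConfig (Site 2)}
    (hA : ω ∈ σ.armsE P b) (hC : ω ∈ σ.corrE P b) : σ.readCfg b ω ∈ extOpenDuoR P.n (4 * P.M) := by
  obtain ⟨i0, i1, -, -, -, haR, hi0, hi1, -, hc0, hc1, hrot, hd0, hd1⟩ := iR_facts hR b
  obtain ⟨F₀, F₁, S₀, S₁, hj₀, hj₁, hw₀, hw₁, hm₀, hm₁, hP₀, hP₁, hS₀, hS₁, ht₀, ht₁, hdj⟩ := hA
  obtain ⟨⟨⟨⟨hSp₀, harc₀⟩, hH₀⟩, hV₀⟩, ⟨⟨⟨hSp₁, harc₁⟩, hH₁⟩, hV₁⟩⟩ := hC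
  -- the reading configuration and the side frames of the two exits
  have e₀ : rotConfig (σ.i (ex b 0)) (colCfg b ω) = rotConfig (σ.iR b 0) (σ.readCfg b ω) := by
    show _ = rotConfig (σ.iR b 0) (rotConfig (σ.rot b) (colCfg b ω))
    rw [rotConfig_rotConfig, ← rotConfig_mod_six (σ.iR b 0 + σ.rot b), hc0]
  have e₁ : rotConfig (σ.i (ex b 1)) (colCfg b ω) = rotConfig ((σ.iR b 1 + 5) % 6) (rotConfig 1 (σ.readCfg b ω)) := by
    show _ = rotConfig _ (rotConfig 1 (rotConfig (σ.rot b) (colCfg b ω)))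
    rw [rotConfig_rotConfig, rotConfig_rotConfig, ← rotConfig_mod_six ((σ.iR b 1 + 5) % 6 + 1 + σ.rot b), hc1]
  set F₀' := F₀.transport e₀ with hF₀'
  set F₁' := F₁.transport e₁ with hF₁'
  have hk₀ : F₀'.k = σ.k P (ex b 0) := by show trapScale P.k₀ F₀.j = _; rw [hj₀]; rfl
  have hk₁ : F₁'.k = σ.k P (ex b 1) := by show trapScale P.k₀ F₁.j = _; rw [hj₁]; rfl
  have hS₀' : S₀ ⊆ (triAnnSet P.n (2 * P.M) ∪ trapExitZone P.M F₀'.z F₀'.k) ∩ rotConfig (σ.iR b 0) (σ.readCfg b ω) := by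
    show S₀ ⊆ (triAnnSet P.n (2 * P.M) ∪ trapExitZone P.M F₀.z F₀.k) ∩ rotConfig (σ.iR b 0) (σ.readCfg b ω)
    rw [← e₀]; exact hS₀
  have hS₁' : S₁ ⊆ (triAnnSet P.n (2 * P.M) ∪ trapExitZone P.M F₁'.z F₁'.k) ∩ rotConfig ((σ.iR b 1 + 5) % 6) (rotConfig 1 (σ.readCfg b ω)) := by
    show S₁ ⊆ (triAnnSet P.n (2 * P.M) ∪ trapExitZone P.M F₁.z F₁.k) ∩ rotConfig ((σ.iR b 1 + 5) % 6) (rotConfig 1 (σ.readCfg b ω))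
    rw [← e₁]; exact hS₁
  -- numeric facts
  obtain ⟨c1, c2, c3, c4, c5, hs1, hdiv, c6, c7, c8, c9, c10, hq, c11, c12, hxd, hlo, hhi⟩ := exit_conditions hV hR (ex b 0)
  obtain ⟨c1', c2', c3', c4', c5', -, hdiv', c6', c7', c8', c9', c10', hq', c11', c12', hxd', hlo', hhi'⟩ := exit_conditions hV hR (ex b 1)
  obtain ⟨-, -, -, -, -, -, -, -, -, hns, hn1, hGE, -, -, -, -, hW, -, hn, hμM, -⟩ := efacts hV hR (ex b 0)
  obtain ⟨-, -, -, -, -, -, -, -, -, hns', hn1', hGE', -, -, -, -, hW', -⟩ := efacts hV hR (ex b 1)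
  obtain ⟨-, -, -, -, -, t1, t2⟩ := apr_facts hV hR (ex b 0)
  obtain ⟨-, -, -, -, -, t1', t2'⟩ := apr_facts hV hR (ex b 1)
  have hnsN : σ.nE P (ex b 0) * P.sA = σ.rE P (ex b 0) := by exact_mod_cast hns
  have hnsN' : σ.nE P (ex b 1) * P.sA = σ.rE P (ex b 1) := by exact_mod_cast hns'
  have hnM : P.n ≤ P.M := by exact_mod_cast hn
  have hM64 : 64 ≤ P.M := by
    have h1 : P.k₀ ≤ P.μ := le_trapScale P.k₀ P.K
    have h2 := hV.toValid.hk₀; have h3 := hV.toValid.hμM; omega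
  have hε : (0 : ℤ) ≤ P.ε := by positivity
  have hsA4 : 2 * (P.ε : ℤ) ≤ P.sA := by
    have := hV.toValid.ifacts.2.2.2.2.2.2.2.1; have := hV.sA_facts.1; omega
  -- the entry tubes
  obtain ⟨hal, hι2, hι3⟩ := align hV hR (ex b 0) (ex b 0)
  obtain ⟨hal', hι2', hι3'⟩ := align hV hR (ex b 1) (ex b 1)
  obtain ⟨ha1, -, ha3⟩ := hR.harc (ex b 0)
  obtain ⟨ha1', -, ha3'⟩ := hR.harc (ex b 1)
  have hTe : ringTube (σ.rE P (ex b 0)) P.eA P.sA (extPos (σ.nE P (ex b 0)) (σ.iR b 0) (σ.ιE P (ex b 0))) ∈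
      arc (thinRing (σ.rE P (ex b 0)) P.eA P.sA) (σ.ast (ex b 0)) (σ.aln (ex b 0)) := by
    have hin := hR.hentry (ex b 0)
    rw [← i0, hGE] at hin
    refine ringTube_mem_arc_of_inArc (by rw [hq]; exact hn1) (by rw [hq, ← hGE]; exact ha1) (by rw [hq]; exact extPos_lt hn1 hi0 (by unfold ASlot.ιE; omega)) ?_
    rw [hq]; exact hin
  have hTe' : ringTube (σ.rE P (ex b 1)) P.eA P.sA (extPos (σ.nE P (ex b 1)) ((σ.iR b 1 + 5) % 6) (σ.ιE P (ex b 1))) ∈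
      arc (thinRing (σ.rE P (ex b 1)) P.eA P.sA) (σ.ast (ex b 1)) (σ.aln (ex b 1)) := by
    have hin := hR.hentry (ex b 1)
    -- the reading side of the second exit in `rotConfig 1 χ` is `(iR b 1 + 5) % 6 = sft (ts a₁) (i' a₁)`
    have hside : sft (ts (ex b 1)) (σ.i' (ex b 1)) = (σ.iR b 1 + 5) % 6 := by
      rw [i1]; unfold sft; have := ts_lt (ex b 0); have := ts_lt (ex b 1)
      have h01 : ts (ex b 1) = ts (ex b 0) + 1 := by
        obtain ⟨u0, u1, u2, u3⟩ := ts_val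
        cases b
        · show ts (ex false 1) = ts (ex false 0) + 1
          rw [show ex false 1 = 3 from rfl, show ex false 0 = 2 from rfl, u2, u3]
        · show ts (ex true 1) = ts (ex true 0) + 1
          rw [show ex true 1 = 1 from rfl, show ex true 0 = 0 from rfl, u0, u1]
      rw [h01]; omega
    rw [hside, hGE'] at hin
    refine ringTube_mem_arc_of_inArc (by rw [hq']; exact hn1') (by rw [hq', ← hGE']; exact ha1')
      (by rw [hq']; exact extPos_lt hn1' (Nat.mod_lt _ (by norm_num)) (by unfold ASlot.ιE; omega)) ?_
    rw [hq']; exact hin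
  have hJ : SpokeMeetsRot (σ.iR b 0) (extSpokeTube P.M F₀'.k (σ.T P (ex b 0)) P.w (σ.L P (ex b 0)) P.ε)
      (ringTube (σ.rE P (ex b 0)) P.eA P.sA (extPos (σ.nE P (ex b 0)) (σ.iR b 0) (σ.ιE P (ex b 0)))) := by
    rw [hk₀]
    refine spokeMeetsRot_ringTube hi0 hs1 hnsN hn1 (by unfold ASlot.ιE; omega) ?_ ?_ c11 c12
    · unfold ASlot.ιE; exact le_of_eq hal
    · unfold ASlot.ιE
      have e := add_one_mul ((latIdx P.sA (σ.rE P (ex b 0)) (σ.ξ P (ex b 0)) : ℕ) : ℤ) (P.sA : ℤ)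
      rw [e]
      have : σ.ξ P (ex b 0) = σ.T P (ex b 0) + P.w + σ.k P (ex b 0) + (σ.k P (ex b 0) / 4 : ℕ) := rfl
      linarith
  have hJ' : SpokeMeetsRot ((σ.iR b 1 + 5) % 6) (extSpokeTube P.M F₁'.k (σ.T P (ex b 1)) P.w (σ.L P (ex b 1)) P.ε)
      (ringTube (σ.rE P (ex b 1)) P.eA P.sA (extPos (σ.nE P (ex b 1)) ((σ.iR b 1 + 5) % 6) (σ.ιE P (ex b 1)))) := by
    rw [hk₁]
    refine spokeMeetsRot_ringTube (Nat.mod_lt _ (by norm_num)) hs1 hnsN' hn1' (by unfold ASlot.ιE; omega) ?_ ?_ c11' c12'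
    · unfold ASlot.ιE; exact le_of_eq hal'
    · unfold ASlot.ιE
      have e := add_one_mul ((latIdx P.sA (σ.rE P (ex b 1)) (σ.ξ P (ex b 1)) : ℕ) : ℤ) (P.sA : ℤ)
      rw [e]
      have : σ.ξ P (ex b 1) = σ.T P (ex b 1) + P.w + σ.k P (ex b 1) + (σ.k P (ex b 1) / 4 : ℕ) := rfl
      linarith
  -- the exit runs
  have hSL : ∀ T ∈ vchunks (σ.rE P (ex b 0)) (-(σ.rE P (ex b 0) : ℤ)) P.eA P.sA (σ.x P (ex b 0)) (P.dA + 1),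
      T ∈ arc (thinRing (σ.rE P (ex b 0)) P.eA P.sA) (σ.ast (ex b 0)) (σ.aln (ex b 0)) := by
    intro T hT
    obtain ⟨g, hg1, hg2, rfl⟩ := exists_pos_of_mem_vchunks (by rw [hq]; exact hxd) hT
    have hin := hR.hrun (ex b 0) g hg1 (by omega)
    rw [hGE] at hin
    refine ringTube_mem_arc_of_inArc (by rw [hq]; exact hn1) (by rw [hq, ← hGE]; exact ha1) (by rw [hq]; omega) ?_
    rw [hq]; exact hin
  have hSL' : ∀ T ∈ vchunks (σ.rE P (ex b 1)) (-(σ.rE P (ex b 1) : ℤ)) P.eA P.sA (σ.x P (ex b 1)) (P.dA + 1),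
      T ∈ arc (thinRing (σ.rE P (ex b 1)) P.eA P.sA) (σ.ast (ex b 1)) (σ.aln (ex b 1)) := by
    intro T hT
    obtain ⟨g, hg1, hg2, rfl⟩ := exists_pos_of_mem_vchunks (by rw [hq']; exact hxd') hT
    have hin := hR.hrun (ex b 1) g hg1 (by omega)
    rw [hGE'] at hin
    refine ringTube_mem_arc_of_inArc (by rw [hq']; exact hn1') (by rw [hq', ← hGE']; exact ha1') (by rw [hq']; omega) ?_
    rw [hq']; exact hin
  -- the regions
  have hz₀ : F₀.z 0 = 2 * (P.M : ℤ) := (mem_trapO.1 F₀.z_mem).2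
  have hz₁ : F₁.z 0 = 2 * (P.M : ℤ) := (mem_trapO.1 F₁.z_mem).2
  have hdj' : Disjoint (triRotIsoPow (σ.iR b 0) '' (S₀ ∪ triStrip (F₀.z 0 + F₀'.k) (F₀.z 1 + F₀'.k) F₀'.k F₀'.k))
      (triRotIsoPow (σ.iR b 1) '' (S₁ ∪ triStrip (F₁.z 0 + F₁'.k) (F₁.z 1 + F₁'.k) F₁'.k F₁'.k)) := by
    have h := disjoint_rot_shift (6 - σ.rot b) hdj
    exact disjoint_rot_congr (by rw [hd0, Nat.mod_eq_of_lt hi0]) (by rw [hd1, Nat.mod_eq_of_lt hi1]) h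
  have hdisj := regions_disjoint hV hR b hk₀ hk₁ hz₀ hz₁ hw₀ hw₁ ht₀ ht₁ hdj'
  -- the landing
  exact extOpenDuoR_of_exits' hnM hM64 hi0 F₀' hP₀ hS₀' hm₀ (by rw [hk₀]; exact c1) (by rw [hk₀]; exact c2) hw₀ c3
    (by rw [hk₀]; exact c4) (by rw [hk₀]; exact c5) (by rw [hk₀]; exact hSp₀) hs1 hdiv c6 c7 harc₀ hTe hJ ⟨t1, t2⟩ hSL hlo hhi hW hH₀ hV₀
    (by rw [hk₀]; exact c8) c9 c10
    (Nat.mod_lt _ (by norm_num)) F₁' hP₁ hS₁' hm₁ (by rw [hk₁]; exact c1') (by rw [hk₁]; exact c2') hw₁ c3'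
    (by rw [hk₁]; exact c4') (by rw [hk₁]; exact c5') (by rw [hk₁]; exact hSp₁) hs1 hdiv' c6' c7' harc₁ hTe' hJ' ⟨t1', t2'⟩ hSL' hlo' hhi' hW'
    hH₁ hV₁ (by rw [hk₁]; exact c8') c9' c10' hdisj

end ASlot

end Literature.Probability.Percolation
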